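import Literature.AlgebraicGeometry.HodgeTheory.HypersurfaceLefschetzUpper
import Literature.AlgebraicGeometry.HodgeTheory.LefschetzOneOneHolds
import HarnessLib

/-!
# Route FiniteTreeOfFlavours — crux `MovableClassesAlgebraic` (stmt-HodgeConjecture-1493): stubs `stub_offMiddle` (line `birth`) and `stub_lefschetzPackage` (line `kou_funnel`)

Two registered stubs of the crux `Theses.FiniteTreeOfFlavours.MovableClassesAlgebraic`, signatures
verbatim, both now theorems of the tree:

* `stub_offMiddle` (STUB 1 of `Cruxes/MovableClassesAlgebraic/Lines/birth.lean`) — off the middle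
  degree, `2k ≠ n`, EVERY class of `H²ᵏ(X(ℂ); ℂ)` of a smooth hypersurface `X ⊂ ℙⁿ⁺¹_ℂ` is algebraic:
  the named Lefschetz fact `Voisin2003_smoothHypersurface_algebraicClasses_eq_top` (Voisin II Cor. 1.24–1.25)
  is DISCHARGED in the tree (`Voisin2003_smoothHypersurface_algebraicClasses_eq_top_holds`,
  `HodgeTheory/HypersurfaceLefschetzUpper`: the Lefschetz hyperplane theorem with `ℂ`-coefficients for
  `V₊(F) ⊂ ℙⁿ⁺¹` below the middle, hard Lefschetz above it), and its membership form for all `2k ≠ n`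
  (`k = 0`, `k ≥ n` by `algebraicClasses_zero` / classes of points / `H²ᵏ = 0`) is the tree's
  `Voisin2003_smoothHypersurface_algebraicClasses_eq_top.mem_algebraicClasses` — the skeleton's own
  `stub_offMiddle_of_fact`.
* `stub_lefschetzPackage` (STUB 1 of `Cruxes/MovableClassesAlgebraic/Lines/kou_funnel.lean`) — the same
  off the middle degree, plus `k ≤ 1` in any degree: `k = 0` is `N⁰ H⁰ = H⁰`, `k = 1` is Lefschetz's
  theorem on `(1,1)`-classes (`lefschetzOneOne_rational_holds`, Voisin I Thm. 11.30).

No definition, no named fact, no `sorry`.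

## References

* [VoisinHodgeII2003] C. Voisin, Hodge Theory and Complex Algebraic Geometry II (2003), §1.2.2
  Thm. 1.23, §1.2.3 Cor. 1.24–1.25.
* [VoisinHodgeI2002] C. Voisin, Hodge Theory and Complex Algebraic Geometry I (2002), Thm. 11.30.
-/

noncomputable section

set_option linter.dupNamespace false

namespace Summit.HodgeConjecture.HodgeConjecture.Theorems

open CategoryTheory AlgebraicGeometry
open Literature.AlgebraicGeometry Literature.AlgebraicGeometry.Motives
open Literature.AlgebraicGeometry.HodgeTheory
open Literature.AlgebraicTopology.SingularHomology

/-- **Registered stub `stub_offMiddle` of the line `birth`** (crux `MovableClassesAlgebraic`,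
stmt-HodgeConjecture-1493): for a smooth hypersurface `X ⊂ ℙⁿ⁺¹_ℂ` of dimension `n` and degree `d` and
every `k` with `2k ≠ n`, every class of `H²ᵏ(X(ℂ); ℂ)` lies in `algebraicClasses X k` — the DISCHARGED
Lefschetz fact `Voisin2003_smoothHypersurface_algebraicClasses_eq_top_holds` (Voisin II Cor. 1.24:
`H²ᵏ(X, ℤ) = ℤ hᵏ` for `2k < n`; Cor. 1.25 above the middle) in membership form
(`Voisin2003_smoothHypersurface_algebraicClasses_eq_top.mem_algebraicClasses`: `k = 0`, `k ≥ n` by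
`algebraicClasses_zero`, classes of points, `H²ᵏ = 0`).
[cite: VoisinHodgeII2003, §1.2.2 Thm. 1.23 and §1.2.3 Cor. 1.24–1.25] -/
theorem stub_offMiddle :
    ∀ ⦃n d : ℕ⦄ ⦃X : SchemeOver ℂ⦄, IsSmoothHypersurface n d X →
      ∀ k : ℕ, 2 * k ≠ n → ∀ c : complexBetti X (2 * k), c ∈ algebraicClasses X k :=
  fun _ _ _ hX _ hk c ↦ Voisin2003_smoothHypersurface_algebraicClasses_eq_top_holds.mem_algebraicClasses hX hk c

/-- **Registered stub `stub_lefschetzPackage` of the line `kou_funnel`** (crux `MovableClassesAlgebraic`,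
stmt-HodgeConjecture-1493): for a smooth hypersurface `X ⊂ ℙⁿ⁺¹_ℂ` of dimension `n`, a rational
`(k,k)`-class `c ∈ H²ᵏ(X(ℂ); ℂ)` is algebraic as soon as `2k ≠ n` (Lefschetz's hyperplane theorem for
hypersurfaces, `stub_offMiddle`; rationality and Hodge type idle) or `k ≤ 1` (`k = 0`: `N⁰ H⁰ = H⁰`;
`k = 1`: Lefschetz's theorem on `(1,1)`-classes, `lefschetzOneOne_rational_holds`).
[cite: VoisinHodgeII2003, §1.2.3 Cor. 1.24–1.25] [cite: VoisinHodgeI2002, Thm. 11.30] -/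
theorem stub_lefschetzPackage :
    ∀ ⦃n d : ℕ⦄ ⦃X : SchemeOver ℂ⦄, IsSmoothHypersurface n d X →
      ∀ k : ℕ, (2 * k ≠ n ∨ k ≤ 1) → ∀ c : complexBetti X (2 * k), IsRationalClass c →
        IsOfHodgeType n X (2 * k) k k c → c ∈ algebraicClasses X k := by
  intro n d X hX k hk c hc hcH
  by_cases h2 : 2 * k ≠ n
  · exact stub_offMiddle hX k h2 c
  · have hk1 : k ≤ 1 := hk.resolve_left h2
    rcases Nat.eq_zero_or_pos k with rfl | hk0
    · rw [algebraicClasses_zero]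
      exact Submodule.mem_top
    · obtain rfl : k = 1 := le_antisymm hk1 hk0
      exact lefschetzOneOne_rational_holds hX.1 c hc hcH

end Summit.HodgeConjecture.HodgeConjecture.Theorems

end
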